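import Literature.NumberTheory.LFunctions.WeilTwoPrimeCellsT120
import HarnessLib

/-!
# Two-prime minorant cells on `[0, 120]`: multi-precision kernel check of cells 55–109

`TPDCell.checkZMP 120 5 weilTwoPrimeCellsT120MP` on chunk 1 of `weilTwoPrimeCellsT120`, by `decide +kernel` (two halves, then the whole chunk by `List.all_append`). Pure proof file; nothing is asserted.
-/

noncomputable section

namespace Literature.NumberTheory.LFunctions

set_option maxHeartbeats 0 in
/-- Kernel check of the first 27 cells of chunk 1. [folklore] -/
theorem checkCells_weilTwoPrimeCellsT120C1a :
    ((weilTwoPrimeCellsT120C1.take 27).all fun c ↦ c.checkZMP 120 5 weilTwoPrimeCellsT120MP) = true := by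
  decide +kernel

set_option maxHeartbeats 0 in
/-- Kernel check of the remaining cells of chunk 1. [folklore] -/
theorem checkCells_weilTwoPrimeCellsT120C1b :
    ((weilTwoPrimeCellsT120C1.drop 27).all fun c ↦ c.checkZMP 120 5 weilTwoPrimeCellsT120MP) = true := by
  decide +kernel

/-- **Kernel check of cells 55–109** (chunk 1) of the two-prime minorant on `[0, 120]`. [folklore] -/
theorem checkCells_weilTwoPrimeCellsT120C1 :
    (weilTwoPrimeCellsT120C1.all fun c ↦ c.checkZMP 120 5 weilTwoPrimeCellsT120MP) = true := by
  rw [← List.take_append_drop 27 weilTwoPrimeCellsT120C1, List.all_append, checkCells_weilTwoPrimeCellsT120C1a, checkCells_weilTwoPrimeCellsT120C1b]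
  rfl

end Literature.NumberTheory.LFunctions
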